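import Mathlib
import Literature.MathematicalPhysics.QuantumFieldTheory.LatticeGaugeStaticPotentialProofs
import Literature.MathematicalPhysics.QuantumFieldTheory.QCDTimeReflection
import Literature.MathematicalPhysics.QuantumLattice.LatticeGaugeDLR
import HarnessLib

/-!
# Stub `stub_axisReflectionsCommute` of the line `purity-rate-split` (crux `FiniteSusceptibilityWeakCoupling`)

Route `FradkinShenkerFlow` of `YangMills`, crux item `stmt-QuantumFields-9442`
(`Summit.QuantumFields.YangMills.Theses.FradkinShenkerFlow.FiniteSusceptibilityWeakCoupling`), line
`purity-rate-split`, stub `stub_axisReflectionsCommute` (W-C of the lead's wave on the purity half).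

**What is proved (the four axis reflections commute and are involutions).** For every group `G`, the
reflection of a `ℤ⁴` lattice gauge field `V : LGConfig 4 G` in the coordinate hyperplane `x_k = 0`,
written in tree vocabulary as the conjugate
`θ_k V := configPermZd (Equiv.swap 0 k) (cfgReflect (configPermZd (Equiv.swap 0 k) V))`
of the site time reflection `cfgReflect` (`QCDTimeReflection`) by the coordinate swap `0 ↔ k`
(`configPermZd`, `LatticeGaugeStaticPotentialProofs`), satisfies `θ_j (θ_k V) = θ_k (θ_j V)` and
`θ_k (θ_k V) = V` for all `j k : Fin 4`.

**Mechanism.** `AxisReflections.axisReflect k` is the direct formula: on an edge `(x, i)`,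
`(θ_k V)(x, i) = V(σ_k x, i)` for `i ≠ k` and `(θ_k V)(x, k) = (V(σ_k x − e_k, k))⁻¹`, where
`σ_k = AxisReflections.siteNeg k` negates the `k`-th coordinate; `axisReflect_eq_conj` identifies it with
the conjugated form (pointwise, from `configPermZd_apply`, `cfgReflect`, `reflectEdge`, `sitePermZd_apply`
and `Equiv.swap` bookkeeping). Commutation (`axisReflect_comm`) and involutivity
(`axisReflect_axisReflect`) are then coordinate computations: `σ_j σ_k = σ_k σ_j`, `σ_k σ_k = id`,
`σ_k (y − e_j) = σ_k y − e_j` (`j ≠ k`) and `σ_k (y − e_k) = σ_k y + e_k`. Also `axisReflect_zero :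
axisReflect 0 = cfgReflect`. Pure combinatorics: every `G`, no measure theory. [folklore]
-/

noncomputable section

open Literature.MathematicalPhysics.QuantumFieldTheory hiding Site ZdEdge
open Literature.MathematicalPhysics.QuantumLattice
open Literature.Probability.LatticeModels hiding configShift configShift_apply

namespace Summit.QuantumFields.YangMills.Theorems.FiniteSusceptibilityWeakCoupling

namespace AxisReflections

/-! ### The coordinate reflections `σ_k` of `ℤ⁴` -/

/-- **Reflection of `ℤ⁴` in the hyperplane `x_k = 0`**: `σ_k x` negates the `k`-th coordinate of `x`
and keeps the others (`σ_0 = siteReflect`). [folklore] -/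
def siteNeg (k : Fin 4) (x : Site 4) : Site 4 := Function.update x k (-x k)

/-- `σ_k` in coordinates. [folklore] -/
theorem siteNeg_apply (k : Fin 4) (x : Site 4) (l : Fin 4) :
    siteNeg k x l = if l = k then -x l else x l := by
  by_cases hl : l = k
  · subst hl; simp [siteNeg]
  · simp [siteNeg, hl]

/-- `σ_0` is the site time reflection `siteReflect`. [folklore] -/
@[simp] theorem siteNeg_zero : siteNeg 0 = siteReflect := rfl

/-- `σ_k` is an involution. [folklore] -/
@[simp] theorem siteNeg_siteNeg (k : Fin 4) (x : Site 4) : siteNeg k (siteNeg k x) = x := by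
  funext l
  simp only [siteNeg_apply]
  split_ifs <;> ring

/-- The coordinate reflections commute. [folklore] -/
theorem siteNeg_comm (j k : Fin 4) (x : Site 4) : siteNeg j (siteNeg k x) = siteNeg k (siteNeg j x) := by
  funext l
  simp only [siteNeg_apply]
  split_ifs <;> ring

/-- `σ_k (x − e_j) = σ_k x − e_j` for `j ≠ k`. [folklore] -/
theorem siteNeg_sub_single_of_ne {j k : Fin 4} (hjk : j ≠ k) (x : Site 4) :
    siteNeg k (x - Pi.single j 1) = siteNeg k x - Pi.single j 1 := by
  funext l
  simp only [siteNeg_apply, Pi.sub_apply, Pi.single_apply]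
  by_cases hl : l = k
  · simp [hl, Ne.symm hjk]
  · simp [hl]

/-- `σ_k (x − e_k) = σ_k x + e_k`. [folklore] -/
theorem siteNeg_sub_single_self (k : Fin 4) (x : Site 4) :
    siteNeg k (x - Pi.single k 1) = siteNeg k x + Pi.single k 1 := by
  funext l
  simp only [siteNeg_apply, Pi.sub_apply, Pi.add_apply, Pi.single_apply]
  split_ifs <;> ring

/-- `σ_k (σ_k x − e_k) − e_k = x` (the reversed `k`-link reflects back onto itself). [folklore] -/
theorem siteNeg_siteNeg_sub_single (k : Fin 4) (x : Site 4) :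
    siteNeg k (siteNeg k x - Pi.single k 1) - Pi.single k 1 = x := by
  rw [siteNeg_sub_single_self, siteNeg_siteNeg, add_sub_cancel_right]

/-- **The swap conjugate of the time reflection of sites is `σ_k`**:
`π (siteReflect (π x)) = σ_k x` for `π = sitePermZd (Equiv.swap 0 k)`. [folklore] -/
theorem sitePermZd_swap_siteReflect (k : Fin 4) (x : Site 4) :
    sitePermZd (Equiv.swap 0 k) (siteReflect (sitePermZd (Equiv.swap 0 k) x)) = siteNeg k x := by
  funext l
  rw [← siteNeg_zero]
  simp only [sitePermZd_apply, Equiv.symm_swap, siteNeg_apply, Equiv.swap_apply_self]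
  by_cases hl : l = k
  · subst hl
    simp
  · have hne : Equiv.swap (0 : Fin 4) k l ≠ 0 := by
      rw [Ne, Equiv.swap_apply_eq_iff, Equiv.swap_apply_left]
      exact hl
    simp [hl, hne]

/-- `sitePermZd (Equiv.swap 0 k)` sends the time unit vector `e_0` to `e_k`. [folklore] -/
theorem sitePermZd_swap_single_zero (k : Fin 4) :
    sitePermZd (Equiv.swap 0 k) (Pi.single 0 1 : Site 4) = Pi.single k 1 := by
  rw [sitePermZd_single, Equiv.swap_apply_left]

/-- The swap conjugate of the reflected reversed time link starts at `σ_k x − e_k`: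
`π (siteReflect (π x) − e_0) = σ_k x − e_k` for `π = sitePermZd (Equiv.swap 0 k)`. [folklore] -/
theorem sitePermZd_swap_siteReflect_sub (k : Fin 4) (x : Site 4) :
    sitePermZd (Equiv.swap 0 k) (siteReflect (sitePermZd (Equiv.swap 0 k) x) - Pi.single 0 1) =
      siteNeg k x - Pi.single k 1 := by
  rw [← sitePermZd_swap_siteReflect k x, ← sitePermZd_swap_single_zero k]
  rfl

/-! ### The axis reflections `θ_k` of gauge fields on `ℤ⁴` -/

variable {G : Type*} [Group G]

/-- **Reflection of a lattice gauge field in the hyperplane `x_k = 0`** (direct formula): links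
transverse to `k` are carried along, `(θ_k U)(x, i) = U(σ_k x, i)` (`i ≠ k`), and the `k`-link
`x → x + e_k` goes to the REVERSED link `σ_k x → σ_k x − e_k`, whence the inverse:
`(θ_k U)(x, k) = U(σ_k x − e_k, k)⁻¹` (`θ_0 = cfgReflect`). [folklore] -/
def axisReflect (k : Fin 4) (U : LGConfig 4 G) : LGConfig 4 G :=
  fun e => if e.2 = k then (U (siteNeg k e.1 - Pi.single k 1, k))⁻¹ else U (siteNeg k e.1, e.2)

/-- `θ_k` evaluated on an edge. [folklore] -/
theorem axisReflect_apply (k : Fin 4) (U : LGConfig 4 G) (x : Site 4) (i : Fin 4) :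
    axisReflect k U (x, i) =
      if i = k then (U (siteNeg k x - Pi.single k 1, k))⁻¹ else U (siteNeg k x, i) := rfl

/-- `θ_k` on a `k`-link. [folklore] -/
@[simp] theorem axisReflect_apply_self (k : Fin 4) (U : LGConfig 4 G) (x : Site 4) :
    axisReflect k U (x, k) = (U (siteNeg k x - Pi.single k 1, k))⁻¹ := by
  simp [axisReflect_apply]

/-- `θ_k` on a link transverse to `k`. [folklore] -/
theorem axisReflect_apply_of_ne (k : Fin 4) (U : LGConfig 4 G) (x : Site 4) {i : Fin 4} (hi : i ≠ k) :
    axisReflect k U (x, i) = U (siteNeg k x, i) := by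
  simp [axisReflect_apply, hi]

/-- **`θ_0` is the site time reflection `cfgReflect`** of `QCDTimeReflection`. [folklore] -/
theorem axisReflect_zero (U : LGConfig 4 G) : axisReflect 0 U = cfgReflect U := by
  funext ⟨x, i⟩
  by_cases hi : i = 0
  · subst hi
    simp [cfgReflect, reflectEdge]
  · simp [axisReflect_apply, cfgReflect, reflectEdge, hi]

/-- **Each axis reflection is an involution**: `θ_k (θ_k U) = U`. [folklore] -/
@[simp] theorem axisReflect_axisReflect (k : Fin 4) (U : LGConfig 4 G) :
    axisReflect k (axisReflect k U) = U := by
  funext ⟨x, i⟩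
  by_cases hi : i = k
  · subst hi
    simp only [axisReflect_apply_self, inv_inv, siteNeg_siteNeg_sub_single]
  · simp only [axisReflect_apply_of_ne _ _ _ hi, siteNeg_siteNeg]

/-- **The axis reflections commute**: `θ_j (θ_k U) = θ_k (θ_j U)`. [folklore] -/
theorem axisReflect_comm (j k : Fin 4) (U : LGConfig 4 G) :
    axisReflect j (axisReflect k U) = axisReflect k (axisReflect j U) := by
  by_cases hjk : j = k
  · subst hjk; rfl
  funext ⟨x, i⟩
  by_cases hij : i = j
  · subst hij
    rw [axisReflect_apply_self, axisReflect_apply_of_ne _ _ _ hjk, axisReflect_apply_of_ne _ _ _ hjk,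
      axisReflect_apply_self, siteNeg_sub_single_of_ne hjk, siteNeg_comm]
  · by_cases hik : i = k
    · subst hik
      rw [axisReflect_apply_of_ne _ _ _ hij, axisReflect_apply_self, axisReflect_apply_self,
        axisReflect_apply_of_ne _ _ _ hij, siteNeg_sub_single_of_ne (Ne.symm hjk), siteNeg_comm]
    · rw [axisReflect_apply_of_ne _ _ _ hij, axisReflect_apply_of_ne _ _ _ hik,
        axisReflect_apply_of_ne _ _ _ hik, axisReflect_apply_of_ne _ _ _ hij, siteNeg_comm]

variable [MeasurableSpace G]

/-- **The conjugated form is the direct formula**: conjugating the time reflection `cfgReflect` by the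
coordinate swap `0 ↔ k` gives `θ_k`,
`configPermZd (swap 0 k) (cfgReflect (configPermZd (swap 0 k) V)) = axisReflect k V`. [folklore] -/
@[simp] theorem axisReflect_eq_conj (k : Fin 4) (V : LGConfig 4 G) :
    configPermZd (Equiv.swap 0 k) (cfgReflect (configPermZd (Equiv.swap 0 k) V)) = axisReflect k V := by
  funext ⟨x, i⟩
  by_cases hi : i = k
  · subst hi
    simp [cfgReflect, reflectEdge, Equiv.symm_swap, Equiv.swap_apply_right, Equiv.swap_apply_left,
      sitePermZd_swap_siteReflect_sub]
  · have hne : Equiv.swap (0 : Fin 4) k i ≠ 0 := by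
      rw [Ne, Equiv.swap_apply_eq_iff, Equiv.swap_apply_left]
      exact hi
    simp [cfgReflect, reflectEdge, Equiv.symm_swap, hne, Equiv.swap_apply_self,
      sitePermZd_swap_siteReflect, axisReflect_apply_of_ne _ _ _ hi]

end AxisReflections

/-- **Stub `stub_axisReflectionsCommute` (W-C) of the line `purity-rate-split`.** The four reflections
`θ_k V := configPermZd (Equiv.swap 0 k) (cfgReflect (configPermZd (Equiv.swap 0 k) V))` (`k : Fin 4`) of a
`ℤ⁴` lattice gauge field in the coordinate hyperplanes `x_k = 0` (conjugates of the site time reflection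
`cfgReflect` by the coordinate swaps `0 ↔ k`) pairwise commute, `θ_j (θ_k V) = θ_k (θ_j V)`, and each is
an involution, `θ_k (θ_k V) = V` — for every group `G` (via the direct formula
`AxisReflections.axisReflect`, `AxisReflections.axisReflect_eq_conj`, `axisReflect_comm`,
`axisReflect_axisReflect`). [folklore] -/
theorem stub_axisReflectionsCommute : ∀ (G : Type) [Group G] [MeasurableSpace G] (j k : Fin 4) (V : Literature.MathematicalPhysics.QuantumLattice.LGConfig 4 G), Literature.MathematicalPhysics.QuantumFieldTheory.configPermZd (Equiv.swap 0 j) (Literature.MathematicalPhysics.QuantumFieldTheory.cfgReflect (Literature.MathematicalPhysics.QuantumFieldTheory.configPermZd (Equiv.swap 0 j) (Literature.MathematicalPhysics.QuantumFieldTheory.configPermZd (Equiv.swap 0 k) (Literature.MathematicalPhysics.QuantumFieldTheory.cfgReflect (Literature.MathematicalPhysics.QuantumFieldTheory.configPermZd (Equiv.swap 0 k) V))))) = Literature.MathematicalPhysics.QuantumFieldTheory.configPermZd (Equiv.swap 0 k) (Literature.MathematicalPhysics.QuantumFieldTheory.cfgReflect (Literature.MathematicalPhysics.QuantumFieldTheory.configPermZd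 (Equiv.swap 0 k) (Literature.MathematicalPhysics.QuantumFieldTheory.configPermZd (Equiv.swap 0 j) (Literature.MathematicalPhysics.QuantumFieldTheory.cfgReflect (Literature.MathematicalPhysics.QuantumFieldTheory.configPermZd (Equiv.swap 0 j) V))))) ∧ Literature.MathematicalPhysics.QuantumFieldTheory.configPermZd (Equiv.swap 0 k) (Literature.MathematicalPhysics.QuantumFieldTheory.cfgReflect (Literature.MathematicalPhysics.QuantumFieldTheory.configPermZd (Equiv.swap 0 k) (Literature.MathematicalPhysics.QuantumFieldTheory.configPermZd (Equiv.swap 0 k) (Literature.MathematicalPhysics.QuantumFieldTheory.cfgReflect (Literature.MathematicalPhysics.QuantumFieldTheory.configPermZd (Equiv.swap 0 k) V))))) = V := by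
  intro G _ _ j k V
  simp only [AxisReflections.axisReflect_eq_conj]
  exact ⟨AxisReflections.axisReflect_comm j k V, AxisReflections.axisReflect_axisReflect k V⟩

end Summit.QuantumFields.YangMills.Theorems.FiniteSusceptibilityWeakCoupling

end
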